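import Literature.NumberTheory.DiophantineGeometry.GenEllProjLine
import Mathlib.Analysis.Normed.Module.FiniteDimension
import Mathlib.Topology.MetricSpace.Ultra.Basic
import Mathlib.NumberTheory.Padics.ProperSpace
import HarnessLib

/-!
# Compactly bounded subsets of `ℙ¹ ∖ {0,1,∞}` exist with any prescribed finite support (non-vacuity)

[GenEll] Ex. 1.3 (ii) [cite: MochizukiGenEll2010, Ex 1.3 (ii) p.5] / Thm. 2.1 (ii) p. 11 quantify
over compactly bounded subsets `K_V ⊆ U_P(Q̄)` "whose support contains `Σ`". This file checks that the
Lean rendering `CBData` of `GenEllProjLine.lean` is INHABITED for every finite set of primes `Σ`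
(`exists_cbData_supportContains`), by the standard example of [GenEll] p. 12 ("unions of
Galois-conjugates of images … of sufficiently small compact neighborhoods"), here simply balls:
`K_∞ := {z ∈ ℂ : |z − 1/2| ≤ 1/4}` and `K_p := {y ∈ Q̄_p : ‖y − 1/2‖ ≤ ‖p‖}` — nonempty compact
domains (closed balls; `p`-adically clopen), conjugation- resp. Galois-stable (the spectral norm on
`Q̄_p` is Galois-invariant, Mathlib `spectralNorm_eq_of_equiv`), avoiding `0` and `1`, and meeting
every finite `K/ℚ_p` in a closed ball of the finite-dimensional (hence proper) normed `ℚ_p`-space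
`K` — and that the `ℚ`-point `λ = 1/2` lies in the resulting `K_V` (`ratPoint_half_mem`), so the sets
`K_V ∩ U_P(Q̄)^{≤d}` of Thm. 2.1 (ii) are nonempty too. Consequently the hypothesis of the named fact
`GenEll_thm21` (statement (ii)) is not vacuously satisfiable through an empty class of `K_V`'s.
-/

noncomputable section

open NumberField Metric

namespace Literature.NumberTheory.DiophantineGeometry.GenEll

namespace CBData

/-- The archimedean bounding domain of the standard example: the closed disc `|z − 1/2| ≤ 1/4`.
[cite: MochizukiGenEll2010, Ex 1.3 (ii) p.5] -/
def stdArc : Set ℂ := closedBall ((2 : ℂ)⁻¹) 4⁻¹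

/-- The nonarchimedean bounding domains of the standard example: the closed balls
`‖y − 1/2‖ ≤ ‖p‖` in `Q̄_p`. [cite: MochizukiGenEll2010, Ex 1.3 (ii) p.5] -/
def stdNon (p : ℕ) [Fact p.Prime] : Set (PadicAlgCl p) := closedBall ((2 : PadicAlgCl p)⁻¹) ‖(p : PadicAlgCl p)‖

/-- `‖p‖ < ‖1/2‖` in `Q̄_p` (`‖p‖ = 1/p < 1 ≤ ‖2‖⁻¹`). [folklore] -/
private theorem norm_p_lt_norm_half (p : ℕ) [Fact p.Prime] :
    ‖(p : PadicAlgCl p)‖ < ‖(2 : PadicAlgCl p)⁻¹‖ := by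
  have hp : ‖(p : PadicAlgCl p)‖ = (p : ℝ)⁻¹ := by
    rw [show (p : PadicAlgCl p) = ((p : ℚ_[p]) : PadicAlgCl p) from
      (map_natCast (algebraMap ℚ_[p] (PadicAlgCl p)) p).symm, PadicAlgCl.norm_extends, Padic.norm_p]
  have h2 : ‖(2 : PadicAlgCl p)‖ ≤ 1 := by
    rw [show (2 : PadicAlgCl p) = ((2 : ℚ_[p]) : PadicAlgCl p) from
      (map_ofNat (algebraMap ℚ_[p] (PadicAlgCl p)) 2).symm, PadicAlgCl.norm_extends]
    simpa using Padic.norm_int_le_one (p := p) 2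
  have h2pos : 0 < ‖(2 : PadicAlgCl p)‖ := norm_pos_iff.mpr (by norm_num)
  rw [norm_inv, hp]
  have hp1 : (1 : ℝ) < p := by exact_mod_cast (Fact.out : p.Prime).one_lt
  calc (p : ℝ)⁻¹ < 1 := inv_lt_one_of_one_lt₀ hp1
    _ ≤ ‖(2 : PadicAlgCl p)‖⁻¹ := one_le_inv_iff₀.mpr ⟨h2pos, h2⟩

/-- The ball `‖y − 1/2‖ ≤ ‖p‖` avoids `0` and `1`. [folklore] -/
private theorem stdNon_subset (p : ℕ) [Fact p.Prime] : stdNon p ⊆ {y | y ≠ 0 ∧ y ≠ 1} := by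
  intro y hy
  rw [stdNon, mem_closedBall, dist_eq_norm] at hy
  have hlt := norm_p_lt_norm_half p
  constructor
  · rintro rfl
    rw [zero_sub, norm_neg] at hy
    exact absurd (hy.trans_lt hlt) (lt_irrefl _)
  · rintro rfl
    have h : (1 : PadicAlgCl p) - 2⁻¹ = 2⁻¹ := by norm_num
    rw [h] at hy
    exact absurd (hy.trans_lt hlt) (lt_irrefl _)

/-- The ball `‖y − 1/2‖ ≤ ‖p‖` is `Gal(Q̄_p/ℚ_p)`-stable (the spectral norm is Galois-invariant,
Mathlib `spectralNorm_eq_of_equiv`). [folklore] -/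
private theorem stdNon_galois (p : ℕ) [Fact p.Prime] (σ : PadicAlgCl p ≃ₐ[ℚ_[p]] PadicAlgCl p)
    (y : PadicAlgCl p) (hy : y ∈ stdNon p) : σ y ∈ stdNon p := by
  rw [stdNon, mem_closedBall, dist_eq_norm] at hy ⊢
  have h : σ y - 2⁻¹ = σ (y - 2⁻¹) := by
    rw [map_sub, map_inv₀, map_ofNat]
  rw [h, ← PadicAlgCl.spectralNorm_eq, ← spectralNorm_eq_of_equiv σ, PadicAlgCl.spectralNorm_eq]
  exact hy

/-- In a finite extension `K/ℚ_p` inside `Q̄_p` the trace of the ball `‖y − 1/2‖ ≤ ‖p‖` is the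
closed ball of the (finite-dimensional, proper) normed space `K`: compact and clopen. [folklore] -/
private theorem stdNon_compactDomain (p : ℕ) [Fact p.Prime] (K : IntermediateField ℚ_[p] (PadicAlgCl p))
    (hK : FiniteDimensional ℚ_[p] K) :
    IsCompact {y : K | (y : PadicAlgCl p) ∈ stdNon p} ∧
      closure (interior {y : K | (y : PadicAlgCl p) ∈ stdNon p}) =
        {y : K | (y : PadicAlgCl p) ∈ stdNon p} := by
  have hmem : ((2 : PadicAlgCl p)⁻¹) ∈ K := by
    rw [show (2 : PadicAlgCl p)⁻¹ = algebraMap ℚ_[p] (PadicAlgCl p) 2⁻¹ by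
      rw [map_inv₀, map_ofNat]]
    exact K.algebraMap_mem _
  set c : K := ⟨(2 : PadicAlgCl p)⁻¹, hmem⟩ with hc
  have hset : {y : K | (y : PadicAlgCl p) ∈ stdNon p} = closedBall c ‖(p : PadicAlgCl p)‖ := by
    ext y
    simp only [stdNon, Set.mem_setOf_eq, mem_closedBall, Subtype.dist_eq, hc]
  rw [hset]
  have hr : ‖(p : PadicAlgCl p)‖ ≠ 0 := norm_ne_zero_iff.mpr (by exact_mod_cast (Fact.out : p.Prime).ne_zero)
  refine ⟨?_, ?_⟩
  · -- `K` is a finite-dimensional normed `ℚ_p`-space, hence proper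
    let K' : Submodule ℚ_[p] (PadicAlgCl p) := K.toSubalgebra.toSubmodule
    haveI : FiniteDimensional ℚ_[p] K' := hK
    haveI : ProperSpace K' := FiniteDimensional.proper ℚ_[p] K'
    have hc' : ((2 : PadicAlgCl p)⁻¹) ∈ K' := hmem
    have himg : (closedBall c ‖(p : PadicAlgCl p)‖ : Set K) =
        (fun y : K' => (⟨(y : PadicAlgCl p), y.2⟩ : K)) '' closedBall (⟨_, hc'⟩ : K') ‖(p : PadicAlgCl p)‖ := by
      ext y
      simp only [mem_closedBall, Set.mem_image, Subtype.dist_eq, hc]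
      constructor
      · intro hy
        exact ⟨⟨(y : PadicAlgCl p), y.2⟩, by simpa [Subtype.dist_eq] using hy, rfl⟩
      · rintro ⟨z, hz, rfl⟩
        simpa [Subtype.dist_eq] using hz
    rw [himg]
    refine (isCompact_closedBall _ _).image ?_
    exact Continuous.subtype_mk (continuous_subtype_val) _
  · rw [(IsUltrametricDist.isClopen_closedBall c hr).isOpen.interior_eq,
      (IsUltrametricDist.isClopen_closedBall c hr).isClosed.closure_eq]

/-- **The standard compactly bounded subset with support `{∞} ∪ S`**, for any finite set `S` of
primes: `K_∞ = {|z − 1/2| ≤ 1/4}`, `K_p = {‖y − 1/2‖ ≤ ‖p‖}`. [cite: MochizukiGenEll2010, Ex 1.3 (ii) p.5] -/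
def std (S : Finset ℕ) (hS : ∀ p ∈ S, p.Prime) : CBData where
  primes := S
  primes_prime := hS
  Karc := stdArc
  Knon := fun p _ => stdNon p
  Karc_nonempty := ⟨2⁻¹, mem_closedBall_self (by norm_num)⟩
  Karc_isCompact := isCompact_closedBall _ _
  Karc_closure_interior := by
    rw [stdArc, interior_closedBall _ (by norm_num), closure_ball _ (by norm_num)]
  Karc_conj := by
    intro z hz
    rw [stdArc, mem_closedBall, dist_eq_norm] at hz ⊢
    have h : (starRingEnd ℂ) z - 2⁻¹ = (starRingEnd ℂ) (z - 2⁻¹) := by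
      rw [map_sub, map_inv₀, map_ofNat]
    rwa [h, RCLike.norm_conj]
  Karc_subset := by
    intro z hz
    rw [stdArc, mem_closedBall, dist_eq_norm] at hz
    constructor
    · rintro rfl
      norm_num at hz
    · rintro rfl
      norm_num at hz
  Knon_nonempty := fun p _ _ => ⟨2⁻¹, mem_closedBall_self (norm_nonneg _)⟩
  Knon_galois := fun p _ _ σ y hy => stdNon_galois p σ y hy
  Knon_compactDomain := fun p _ _ K hK => stdNon_compactDomain p K hK
  Knon_subset := fun p _ _ => stdNon_subset p

/-- **Non-vacuity of the class of compactly bounded subsets**: for every finite set `S` of prime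
numbers there is a compactly bounded subset of `U_P(Q̄)` whose support contains `S`.
[cite: MochizukiGenEll2010, Ex 1.3 (ii) p.5] -/
theorem exists_cbData_supportContains (S : Finset ℕ) (hS : ∀ p ∈ S, p.Prime) :
    ∃ D : CBData, D.SupportContains S :=
  ⟨std S hS, subset_rfl⟩

/-- The `ℚ`-point `λ = 1/2` lies in the standard compactly bounded subset (every embedding of `ℚ`
sends `1/2` to `1/2`, the centre of each ball); so `K_V ∩ U_P(Q̄)^{≤ d} ≠ ∅` for all `d ≥ 1`.
[cite: MochizukiGenEll2010, Ex 1.3 (ii) p.6] -/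
theorem ratPoint_half_mem (S : Finset ℕ) (hS : ∀ p ∈ S, p.Prime) :
    ratPoint 2⁻¹ ∈ (std S hS).toSet := by
  have hx : (ratPoint (2⁻¹ : ℚ)).x = (2 : (ratPoint (2⁻¹ : ℚ)).F)⁻¹ := rfl
  refine ⟨fun σ => ?_, fun p _ _ σ => ?_⟩
  · change σ (ratPoint (2⁻¹ : ℚ)).x ∈ stdArc
    rw [hx, map_inv₀, map_ofNat]
    exact mem_closedBall_self (by norm_num)
  · change σ (ratPoint (2⁻¹ : ℚ)).x ∈ stdNon p
    rw [hx, map_inv₀, map_ofNat]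
    exact mem_closedBall_self (norm_nonneg _)

end CBData

end Literature.NumberTheory.DiophantineGeometry.GenEll

end
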